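import Literature.AnabelianGeometry.EtaleTheta.Discharge.Sec3Prop34CnstOfRlfRSupportNegativeCone
import HarnessLib

/-!
# [EtTh] Prop 3.4 (ii) / Def 3.6 (i), `Λ = ℝ`: WITHOUT finite prime support the effective-locus clause FAILS even when
# every prime is a `ℚ`-prime — a kernel counterexample over `Φ₀ = ∏_{ℚ_{≥0}} ℚ_{≥0}` (infinitely many primes)

NEGATIVE companion (a counterexample; carries the definitions of its witness) of
`Discharge/Sec3Prop34CnstOfRlfRSupport.lean` in the series `Discharge/Sec3*.lean`, cell abc-iut, sub-DAG
`plan/L2/SUBDAG-EtTh-Thm37.md`, row «EtTh:Thm3.7(iii)/L10-R» — GAP-LEDGER G-w5d130-1, the case its D-row 06:16:56Z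
leaves open («objects `Y` with INFINITELY many primes»).  S. Mochizuki, *The étale theta function …*, Publ. RIMS **45**
(2009) [EtTh], §3, Prop. 3.4 (ii) p.74, Def. 3.6 (i) p.76, Thm. 3.7 (iii) p.79 (PDF) [cite: MochizukiEtTh2009,
Prop 3.4 (ii) p.74]; S. Mochizuki, *The geometry of Frobenioids I* [FrdI], §0 p.10–12, Def. 2.4 (i) p.47
[cite: MochizukiFrdI2008, Def. 2.4(i) p.47].

KNOWN: the `Λ = ℝ` effective-locus clause `hE` ("an element of `ℝ·Φ₀^birat(Y)` with effective image in
`(Φ₀^rlf)^gp(Y)` lies in `ℝ·Φ₀^cnst(Y)`", clause 1 of `RealifiedDivisorMonoids.Prop34Cnst (ofRlfR dm hpf) cnst`) is NOT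
a consequence of the `B₀`-level Prop. 3.4 (ii) over abstract data with `ℝ`-primes (abc-iut-w5-d130,
`Sec3Prop34CnstOfRlfRNegative.lean`: `Φ₀ = ℝ_{≥0}³`), and IS one when `Φ₀(Y)` has finitely many primes, all `ℚ`-primes
(`Sec3Prop34CnstOfRlfRFinite.lean`), more generally when every element of `Φ₀(Y)^pf` has finite prime support
(`Sec3Prop34CnstOfRlfRSupport.lean`, this seat).  THIS FILE: the finite-support hypothesis cannot be dropped — with
ONLY `ℚ`-primes but infinitely supported divisors the clause fails.  Witness `dm₁` over the one-object base:
`Φ₀ := ∏_{j ∈ ℚ_{≥0}} ℚ_{≥0}` (a full product of perfect `ℚ`-monoprime monoids: perf-factorial by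
`PiMonoprime.isPerfFactorial`; `Prime(Φ₀^pf) ≅ ℚ_{≥0}`, every `M^pf_𝔮 ≅ ℚ_{≥0}` — `hQ`), `B₀ := ℤ²` with
`div₀(e₁) = u := 𝟙_{j² < 2} − 𝟙_{j² > 2}`, `div₀(e₂) = v := −j·𝟙_{j² < 2} + j·𝟙_{j² > 2}` (additive coordinates,
`j ∈ ℚ_{≥0}`; `j² = 2` has no rational solution), `F₀ := 0`.  A real combination `a·u + b·v` is effective iff
`a ≥ j·b` for all rational `0 ≤ j < √2` and `a ≤ j·b` for all rational `j > √2`, i.e. iff `(a, b) ∈ ℝ_{≥0}·(√2, 1)`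
(`eq_sqrt_two_mul_of_forall_nonneg`, density of `ℚ` in `ℝ`): NO lattice point but `0` (`√2 ∉ ℚ`), so `Prop34` HOLDS
(`prop34`; `Prop34Cnst₀ (𝟭 _)` trivially), while `β := √2 • ι(u) · ι(v) ∈ ℝ·Φ₀^birat(Y₀)` is EFFECTIVE (its prime
coordinates are `κ_𝔮 · (√2 − j) > 0`, resp. `κ_𝔮 · (j − √2) > 0` — `β_effective`, via the explicit prime coordinates
of a full product, `exists_coord_eq_mul_eval`) and `≠ 0 = ℝ·Φ₀^cnst(Y₀)`.  Hence **`not_forall_eff_of_ratPrimes`**: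
abc-iut-w5-d130's `eff_of_finite_ratPrimes` with `[Finite (Primes (Perfection (Φ₀ Y)))]` dropped is FALSE, and
**`not_forall_prop34Cnst_ofRlfR_of_ratPrimes`** (`ofRlfR_of_finite_ratPrimes` without `hfin` is false).
Content for G-w5d130-1 / the 13:00Z v-next: over the typed Def. 3.3 (iii) data, `hE` ⟸ Prop. 3.4 (ii) + `ℚ`-primes +
finite support (positive companion) and ⇍ without finite support (this file); the genuine `Ÿ`-type objects of
[EtTh] §1–§2 have infinitely many special-fibre components and log-meromorphic functions with infinitely supported
divisors (`div(U) = Σ_j j·C_j`), so there `hE` is NOT supplied by the abstract interface — it must be recorded as an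
interface clause or derived from the geometry of `B₀(Ÿ)`.  HONEST FRAMING: a statement about the cell's abstract
interfaces, not about print's geometric data (for which Prop. 3.4 (ii) is a theorem of [EtTh]); nothing here bears on
[IUTchIII] Cor. 3.12.  Scaffolding (`dm₁`, `prop34`, `Prop34Cnst₀`, `β_mem`, `eq_one_of_mem_realSpan_cnstGp`) follows
abc-iut-w5-d130's `Sec3Prop34CnstOfRlfRNegative.lean` line by line.
-/

noncomputable section

namespace Literature.AnabelianGeometry.EtaleTheta

open CategoryTheory Opposite Literature.AlgebraicGeometry.Frobenioids NNReal

namespace Sec3Prop34CnstOfRlfRSupportNegative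

/-! ### The Def. 3.3 (iii) data `dm₁` over the one-object base category; Prop. 3.4 holds for them -/

/-- **The data `(Φ₀, B₀, B₀ → Φ₀^gp, F₀)`**: `Φ₀ = ∏_{ℚ_{≥0}} ℚ_{≥0}`, `B₀ = ℤ²`, `div₀ = divH`, `F₀ = 0`, everything
non-cuspidal, over the one-object base category. [cite: MochizukiEtTh2009, Def 3.3 p.73] -/
def dm₁ : DivisorMonoids.{0, 0, 0} (Discrete PUnit.{1}) where
  Φ₀ := (Functor.const _).obj (CommMonCat.of M)
  B₀ := (Functor.const _).obj (CommMonCat.of B)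
  isUnit_B₀ _ b := by
    change IsUnit (M := B) b
    exact Group.isUnit _
  div₀ _ := divH
  div₀_natural _ b := by
    change divH b = gpMap (MonoidHom.id M) (divH b)
    rw [gpMap_eq_monGpMap, MonGp.map_id, MonoidHom.id_apply]
  F₀ _ := ⊥
  F₀_map _ _ hb := hb
  ncsp₀ _ := ⊤
  csp₀ _ := ⊥
  ncsp₀_map _ _ _ := trivial
  csp₀_map _ x hx := by
    rw [Submonoid.mem_bot] at hx ⊢
    rw [hx, map_one]
  existsUnique_ncsp_csp _ x := by
    refine ⟨(⟨x, trivial⟩, ⟨1, Submonoid.mem_bot.mpr rfl⟩), mul_one x, ?_⟩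
    rintro ⟨a, c⟩ h
    have hc : c.1 = 1 := Submonoid.mem_bot.mp c.2
    have ha : a.1 = x := by
      have h' : a.1 * c.1 = x := h
      rwa [hc, mul_one] at h'
    exact Prod.ext (Subtype.ext ha) (Subtype.ext hc)

/-- `Φ₀(Y) = ∏_{ℚ_{≥0}} ℚ_{≥0}` is perf-factorial at every object (the constructor's hypothesis of `ofRlfR`).
[cite: MochizukiEtTh2009, Prop 3.4 p.74] -/
theorem hpf₁ : ∀ Y : (Discrete PUnit.{1})ᵒᵖ, IsPerfFactorial (dm₁.Φ₀.obj Y) := fun _ => hpfM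

/-- **Prop. 3.4 for `dm₁` over the TREE's [FrdI] vocabulary**: `Φ₀` perf-factorial, identity endomorphisms
non-dilating, `Φ₀` a divisorial monoid on the one-object category, and — the two clauses with content — kernel and
effective locus of `B₀ → Φ₀^gp` inside `F₀ = 0` (`eq_one_of_c_divH_nonneg`). [cite: MochizukiEtTh2009, Prop 3.4 p.74] -/
theorem prop34 (IsRat IsSRat : ((Discrete PUnit.{1})ᵒᵖ ⥤ CommMonCat.{0}) → Prop) :
    dm₁.Prop34 treeMonoidVocab (treeCatVocab (Discrete PUnit.{1}) IsRat IsSRat) where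
  isPerfFactorial Y := hpf₁ Y
  isNonDilating Y f _ := by
    change associatesMap (MonoidHom.id M) = MonoidHom.id _
    ext x
    obtain ⟨m, rfl⟩ := Associates.mk_surjective x
    rw [associatesMap_mk]
    rfl
  isDivisorialOn := by
    refine ⟨⟨fun α => ⟨fun a b h => h, fun x y h => ?_⟩, fun α _ => Function.bijective_id⟩,
      fun _ => PiMonoprime.isDivisorial (P := fun _ : ℚ≥0 => Multiplicative ℚ≥0) hP⟩
    obtain ⟨a, rfl⟩ := Associates.mk_surjective x
    obtain ⟨b, rfl⟩ := Associates.mk_surjective y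
    rw [associatesMap_mk, associatesMap_mk] at h
    exact h
  ker_div₀_le_F₀ Y g hg := by
    change divH g = 1 at hg
    exact Submonoid.mem_bot.mpr (eq_one_of_c_divH_nonneg g fun j => by rw [hg, c, map_one, toAdd_one])
  mem_F₀_of_div₀_mem Y g x hg := by
    change divH g = Algebra.GrothendieckGroup.of x at hg
    exact Submonoid.mem_bot.mpr (eq_one_of_c_divH_nonneg g fun j => by rw [hg]; exact c_of_nonneg j x)

/-- `Prop34Cnst₀` for `dm₁` and `cnst := 𝟭` (the one-object base has only identity morphisms).
[cite: MochizukiEtTh2009, Prop 3.4 (ii) p.74] -/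
theorem prop34Cnst₀ : dm₁.Prop34Cnst₀ (𝟭 (Discrete PUnit.{1})) where
  B₀_map_eq_of_cnst_map_eq g g' _ _ _ := by rw [Subsingleton.elim g g']
  Φ₀_map_eq_of_cnst_map_eq g g' _ _ _ := by rw [Subsingleton.elim g g']
  cnst_map_eq_of_B₀_map_eq g g' _ := Subsingleton.elim _ _

/-! ### The real prime coordinates of `u`, `v` on `(Φ₀^rlf)^gp` -/

/-- The canonical map `Φ₀^gp → (Φ₀^rlf)^gp`, `[m] ↦ [ι m]` (the home of the prime coordinates).
[cite: MochizukiFrdI2008, Prop. 5.3 p.103] -/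
abbrev ιg : Algebra.GrothendieckGroup M →* Algebra.GrothendieckGroup hpfM.Rlf :=
  MonGp.map (hpfM.toRealification.comp (Perfection.of M))

section Coord

variable (𝔮' : Primes (Perfection M)) (f : RlfAt M 𝔮' ≃* Multiplicative ℝ≥0)

/-- The real prime coordinate `X(w) := coord_𝔮'([ι w])` of `w ∈ Φ₀^gp`. [cite: MochizukiFrdI2008, Def. 2.4(i) p.48] -/
def X (w : Algebra.GrothendieckGroup M) : ℝ := Multiplicative.toAdd (PrimeCoord.coordGp hpfM 𝔮' f (ιg w))

/-- `X` on quotients. [cite: MochizukiFrdI2008, Def. 2.4(i) p.47] -/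
theorem X_div (w w' : Algebra.GrothendieckGroup M) : X 𝔮' f (w / w') = X 𝔮' f w - X 𝔮' f w' := by
  rw [X, map_div, map_div, toAdd_div, X, X]

/-- `X[m] = κ · m(j(𝔮'))` given the coordinate formula. [cite: MochizukiFrdI2008, Def. 2.4(i) p.48] -/
theorem X_of {κ : ℝ≥0}
    (hκ : ∀ m : M, Multiplicative.toAdd (PrimeCoord.coord hpfM 𝔮' f (hpfM.toRealification (Perfection.of M m))) =
      κ * ((Multiplicative.toAdd (m (jdx 𝔮')) : ℚ≥0) : ℝ≥0)) (m : M) :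
    X 𝔮' f (Algebra.GrothendieckGroup.of m) = (κ : ℝ) * ((Multiplicative.toAdd (m (jdx 𝔮')) : ℚ≥0) : ℝ) := by
  rw [X, MonGp.map_of, PrimeCoord.toAdd_coordGp_of, MonoidHom.comp_apply, hκ m, NNReal.coe_mul]
  rfl

/-- The coordinate vector of `u` as reals. [cite: MochizukiEtTh2009, Def 3.3 p.73] -/
def UR (j : ℚ≥0) : ℝ := if j * j < 2 then 1 else -1
/-- The coordinate vector of `v` as reals. [cite: MochizukiEtTh2009, Def 3.3 p.73] -/
def VR (j : ℚ≥0) : ℝ := if j * j < 2 then -(j : ℝ) else (j : ℝ)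

/-- `X(u) = κ · UR(j(𝔮'))`. [cite: MochizukiEtTh2009, Def 3.3 p.73] -/
theorem X_u {κ : ℝ≥0}
    (hκ : ∀ m : M, Multiplicative.toAdd (PrimeCoord.coord hpfM 𝔮' f (hpfM.toRealification (Perfection.of M m))) =
      κ * ((Multiplicative.toAdd (m (jdx 𝔮')) : ℚ≥0) : ℝ≥0)) :
    X 𝔮' f u = (κ : ℝ) * UR (jdx 𝔮') := by
  rw [u, X_div, X_of 𝔮' f hκ, X_of 𝔮' f hκ]
  simp only [uP, uN, UR]
  split_ifs <;> simp

/-- `X(v) = κ · VR(j(𝔮'))`. [cite: MochizukiEtTh2009, Def 3.3 p.73] -/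
theorem X_v {κ : ℝ≥0}
    (hκ : ∀ m : M, Multiplicative.toAdd (PrimeCoord.coord hpfM 𝔮' f (hpfM.toRealification (Perfection.of M m))) =
      κ * ((Multiplicative.toAdd (m (jdx 𝔮')) : ℚ≥0) : ℝ≥0)) :
    X 𝔮' f v = (κ : ℝ) * VR (jdx 𝔮') := by
  rw [v, X_div, X_of 𝔮' f hκ, X_of 𝔮' f hκ]
  simp only [vP, vN, VR]
  split_ifs <;> simp

/-- `√2 · UR(j) + VR(j) ≥ 0` at every index (`√2 − j > 0` for `j < √2`, `j − √2 ≥ 0` for `j > √2`). [cite: MochizukiEtTh2009, Prop 3.4 (ii) p.74] -/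
theorem sqrt_two_mul_UR_add_VR_nonneg (j : ℚ≥0) : 0 ≤ Real.sqrt 2 * UR j + VR j := by
  by_cases hj : j * j < 2
  · rw [UR, VR, if_pos hj, if_pos hj]
    have := (sq_lt_two_iff j).mp hj
    linarith
  · rw [UR, VR, if_neg hj, if_neg hj]
    have := not_lt.mp ((not_congr (sq_lt_two_iff j)).mp hj)
    linarith

end Coord

/-! ### The element `β := √2 • ι(u) · ι(v) ∈ ℝ·Φ₀^birat(Y₀)`: effective, not constant -/

/-- The base object. [cite: MochizukiEtTh2009, Def 3.3 p.73] -/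
def Y₀ : Discrete PUnit.{1} := ⟨PUnit.unit⟩

/-- `div₀(e₁) = u`, typed over the data `dm₁`. [cite: MochizukiEtTh2009, Def 3.3 p.73] -/
theorem div₀_e₁ : dm₁.div₀ (op Y₀) (Multiplicative.ofAdd 1, 1) = u := by
  change divH _ = _
  rw [divH_apply, toAdd_ofAdd, zpow_one, toAdd_one, zpow_zero, mul_one]

/-- `div₀(e₂) = v`, typed over the data `dm₁`. [cite: MochizukiEtTh2009, Def 3.3 p.73] -/
theorem div₀_e₂ : dm₁.div₀ (op Y₀) (1, Multiplicative.ofAdd 1) = v := by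
  change divH _ = _
  rw [divH_apply, toAdd_one, zpow_zero, one_mul, toAdd_ofAdd, zpow_one]

/-- `β := √2 • [ι u] · [ι v] ∈ (Φ₀^rlf)^gp(Y₀)` — additively `√2·u + v` (written in the home of the prime
coordinates `(M^rlf)^gp`; it is the element `√2 • ι^gp(div₀ e₁) · ι^gp(div₀ e₂)` of the realification datum, `β_eq_rsmul`).
[cite: MochizukiEtTh2009, Def 3.6 p.76] -/
def β : Algebra.GrothendieckGroup hpfM.Rlf := IsPerfFactorial.Rlf.realSMul hpfM (Real.sqrt 2) (ιg u) * ιg v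

/-- `β = √2 • ι^gp(div₀ e₁) · ι^gp(div₀ e₂)` for THE realification datum of `dm₁`. [cite: MochizukiEtTh2009, Def 3.6 p.76] -/
theorem β_eq_rsmul : β =
    (RealifiedDivisorMonoids.realData dm₁ hpf₁).rsmul Y₀ (Real.sqrt 2)
        ((RealifiedDivisorMonoids.realData dm₁ hpf₁).toRlfGp Y₀ (dm₁.div₀ (op Y₀) (Multiplicative.ofAdd 1, 1))) *
      (RealifiedDivisorMonoids.realData dm₁ hpf₁).toRlfGp Y₀ (dm₁.div₀ (op Y₀) (1, Multiplicative.ofAdd 1)) := by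
  rw [div₀_e₁, div₀_e₂]
  rfl

/-- `β ∈ ℝ·Φ₀^birat(Y₀) = B₀^ℝ(Y₀)` (product of the generators `√2 • ι(u)`, `1 • ι(v)`, `u, v ∈ Φ₀^birat`).
[cite: MochizukiEtTh2009, Def 3.6 p.76] -/
theorem β_mem : β ∈ ((RealifiedDivisorMonoids.realData dm₁ hpf₁).realSpan dm₁.biratGp).carrier Y₀ := by
  rw [β_eq_rsmul]
  refine Subgroup.mul_mem _
    (Subgroup.subset_closure ⟨_, dm₁.div₀ (op Y₀) (Multiplicative.ofAdd 1, 1), ?_, rfl⟩)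
    (Subgroup.subset_closure ⟨1, dm₁.div₀ (op Y₀) (1, Multiplicative.ofAdd 1), ?_, ?_⟩)
  · exact Subgroup.subset_closure ⟨(Multiplicative.ofAdd 1, 1), rfl⟩
  · exact Subgroup.subset_closure ⟨(1, Multiplicative.ofAdd 1), rfl⟩
  · exact ((RealifiedDivisorMonoids.realData dm₁ hpf₁).rsmul_one Y₀ _).symm

/-- **The prime coordinates of `β`**: `coord_𝔮'(β) = κ · (√2 · UR(j) + VR(j))`, `j = j(𝔮')`.
[cite: MochizukiFrdI2008, Def. 2.4(i) p.48] -/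
theorem toAdd_coordGp_β (𝔮' : Primes (Perfection M)) (f : RlfAt M 𝔮' ≃* Multiplicative ℝ≥0) {κ : ℝ≥0}
    (hκ : ∀ m : M, Multiplicative.toAdd (PrimeCoord.coord hpfM 𝔮' f (hpfM.toRealification (Perfection.of M m))) =
      κ * ((Multiplicative.toAdd (m (jdx 𝔮')) : ℚ≥0) : ℝ≥0)) :
    Multiplicative.toAdd (PrimeCoord.coordGp hpfM 𝔮' f β) =
      (κ : ℝ) * (Real.sqrt 2 * UR (jdx 𝔮') + VR (jdx 𝔮')) := by
  rw [β, map_mul, toAdd_mul, PrimeCoord.toAdd_coordGp_realSMul]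
  change Real.sqrt 2 * X 𝔮' f u + X 𝔮' f v = _
  rw [X_u 𝔮' f hκ, X_v 𝔮' f hκ]
  ring

/-- Every prime coordinate of `β` is `≥ 0`. [cite: MochizukiFrdI2008, Def. 2.4(i) p.48] -/
theorem coordGp_β_nonneg (𝔮' : Primes (Perfection M)) (f : RlfAt M 𝔮' ≃* Multiplicative ℝ≥0) :
    0 ≤ Multiplicative.toAdd (PrimeCoord.coordGp hpfM 𝔮' f β) := by
  obtain ⟨κ, -, hκ⟩ := exists_coord_eq_mul_eval 𝔮' f
  rw [toAdd_coordGp_β 𝔮' f hκ]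
  exact mul_nonneg (NNReal.coe_nonneg κ) (sqrt_two_mul_UR_add_VR_nonneg _)

/-- A family of charts `M^rlf_𝔮' ≅ ℝ_{≥0}` (they exist: every `M^pf_𝔮'` is monoprime). [cite: MochizukiFrdI2008, §0 p.10] -/
def chart (𝔮' : Primes (Perfection M)) : RlfAt M 𝔮' ≃* Multiplicative ℝ≥0 :=
  (RealificationCoord.nonempty_coord (IsMonoprime.ofQ (hQ 𝔮'))).some

/-- **`β` is EFFECTIVE**: it is the class of an element of `Φ₀^rlf(Y₀)` (all prime coordinates `≥ 0`,
`PrimeCoord.exists_eq_of_of_coordGp_nonneg`). [cite: MochizukiEtTh2009, Def 3.6 p.76] -/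
theorem β_effective : ∃ y : hpfM.Rlf, β = Algebra.GrothendieckGroup.of y :=
  PrimeCoord.exists_eq_of_of_coordGp_nonneg chart β fun 𝔮' => coordGp_β_nonneg 𝔮' (chart 𝔮')

/-- `ℝ·Φ₀^cnst(Y₀) = 0` (as `F₀ = 0`): every element of the `ℝ`-span of `Φ₀^cnst` is trivial.
[cite: MochizukiEtTh2009, Def 3.6 p.76] -/
theorem eq_one_of_mem_realSpan_cnstGp {x : Algebra.GrothendieckGroup hpfM.Rlf}
    (hx : x ∈ ((RealifiedDivisorMonoids.realData dm₁ hpf₁).realSpan dm₁.cnstGp).carrier Y₀) : x = 1 := by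
  have hle : ((RealifiedDivisorMonoids.realData dm₁ hpf₁).realSpan dm₁.cnstGp).carrier Y₀ ≤ ⊥ := by
    refine (Subgroup.closure_le _).mpr ?_
    rintro _ ⟨r, c, hc, rfl⟩
    have hle' : dm₁.cnstGp.carrier Y₀ ≤ ⊥ := by
      refine (Subgroup.closure_le _).mpr ?_
      rintro _ ⟨g, hg, rfl⟩
      rw [show g = 1 from Submonoid.mem_bot.mp hg, map_one]
      exact (⊥ : Subgroup _).one_mem
    rw [show c = 1 from Subgroup.mem_bot.mp (hle' hc), map_one, map_one]
    exact (⊥ : Subgroup _).one_mem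
  exact Subgroup.mem_bot.mp (hle hx)

/-- **`β` is NOT trivial**: its coordinate at the prime of index `0` is `κ · √2 > 0`.
[cite: MochizukiEtTh2009, Def 3.6 p.76] -/
theorem β_ne_one : β ≠ 1 := by
  classical
  intro h1
  let 𝔮₀ : Primes (Perfection M) := Primes.congr eM (PiMonoprime.primeOf hP 0)
  obtain ⟨κ, hκ0, hκ⟩ := exists_coord_eq_mul_eval 𝔮₀ (chart 𝔮₀)
  have hval := toAdd_coordGp_β 𝔮₀ (chart 𝔮₀) hκ
  rw [h1, map_one, toAdd_one, show jdx 𝔮₀ = 0 from jdx_congr_primeOf 0, UR, VR,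
    if_pos (by norm_num), if_pos (by norm_num)] at hval
  simp only [NNRat.cast_zero, neg_zero, add_zero, mul_one] at hval
  have hpos : (0 : ℝ) < (κ : ℝ) * Real.sqrt 2 :=
    mul_pos (NNReal.coe_pos.mpr (pos_iff_ne_zero.mpr hκ0)) (Real.sqrt_pos.mpr (by norm_num))
  exact hpos.ne hval

/-- **At `Y₀` the `Λ = ℝ` effective-locus clause `hE` FAILS for `dm₁`** — although `Prop34` holds and every prime of
`Φ₀(Y₀)^pf` is `ℚ`-monoprime: `β ∈ ℝ·Φ₀^birat(Y₀)` is effective but not in `ℝ·Φ₀^cnst(Y₀) = 0`.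
[cite: MochizukiEtTh2009, Prop 3.4 (ii) p.74] -/
theorem not_eff :
    ¬ ∀ (b : Algebra.GrothendieckGroup ((RealifiedDivisorMonoids.realData dm₁ hpf₁).rlf.obj (op Y₀)))
        (x : (hpf₁ (op Y₀)).Rlf),
        b ∈ ((RealifiedDivisorMonoids.realData dm₁ hpf₁).realSpan dm₁.biratGp).carrier Y₀ →
        b = Algebra.GrothendieckGroup.of x →
        b ∈ ((RealifiedDivisorMonoids.realData dm₁ hpf₁).realSpan dm₁.cnstGp).carrier Y₀ := by
  intro h
  obtain ⟨y, hy⟩ := β_effective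
  exact β_ne_one (eq_one_of_mem_realSpan_cnstGp (h β y β_mem hy))

/-- **`Prop34Cnst (ofRlfR dm₁ hpf₁) (𝟭 _)` FAILS** (its first clause is `hE` at every object).
[cite: MochizukiEtTh2009, Prop 3.4 (ii) p.74] -/
theorem not_prop34Cnst_ofRlfR :
    ¬ (RealifiedDivisorMonoids.ofRlfR dm₁ hpf₁).Prop34Cnst (𝟭 (Discrete PUnit.{1})) :=
  fun h => not_eff (RealifiedDivisorMonoids.Prop34Cnst.eff_of_prop34Cnst_ofRlfR h Y₀)

/-! ### The universally quantified statements refuted -/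

/-- **`eff_of_finite_ratPrimes` WITHOUT the finiteness of `Prime(Φ₀(Y))` is FALSE**: `Prop34` + "every
`M^pf_𝔮` is `ℚ`-monoprime" do NOT imply the `Λ = ℝ` effective-locus clause `hE` — witnessed by `dm₁`
(`Φ₀ = ∏_{ℚ_{≥0}} ℚ_{≥0}`, `B₀ = ℤ·u ⊕ ℤ·v`, `F₀ = 0`) over the one-object base category (universe-`0` instance of
the universally quantified statement).  Hence the finite-SUPPORT hypothesis of
`Sec3Prop34CnstOfRlfRSupport.eff_of_finSupp_ratPrimes` cannot be dropped either.
[cite: MochizukiEtTh2009, Prop 3.4 (ii) p.74] -/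
theorem not_forall_eff_of_ratPrimes :
    ¬ ∀ (D₀ : Type) [Category.{0} D₀] (dm : DivisorMonoids.{0, 0, 0} D₀)
        (hpf : ∀ Y : D₀ᵒᵖ, IsPerfFactorial (dm.Φ₀.obj Y)) (V : FrdIMonoidStub.{0}) (V₀ : FrdICatStub.{0, 0, 0} D₀),
        dm.Prop34 V V₀ → ∀ (Y : D₀),
        (∀ 𝔮 : Primes (Perfection (dm.Φ₀.obj (op Y))), IsQMonoprime (PfAt (dm.Φ₀.obj (op Y)) 𝔮)) →
        ∀ (b : Algebra.GrothendieckGroup ((RealifiedDivisorMonoids.realData dm hpf).rlf.obj (op Y)))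
          (x : (hpf (op Y)).Rlf),
          b ∈ ((RealifiedDivisorMonoids.realData dm hpf).realSpan dm.biratGp).carrier Y →
          b = Algebra.GrothendieckGroup.of x →
          b ∈ ((RealifiedDivisorMonoids.realData dm hpf).realSpan dm.cnstGp).carrier Y :=
  fun h => not_eff (h _ dm₁ hpf₁ treeMonoidVocab (treeCatVocab (Discrete PUnit.{1}) (fun _ => True) (fun _ => True))
    (prop34 (fun _ => True) (fun _ => True)) Y₀ hQ)

/-- **`ofRlfR_of_finite_ratPrimes` WITHOUT the finiteness of `Prime(Φ₀(Y))` is FALSE**: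
`Prop34 ∧ Prop34Cnst₀ ∧ (all M^pf_𝔮 ℚ-monoprime) ⇏ Prop34Cnst (ofRlfR dm hpf) cnst`, witnessed by `dm₁` with
`cnst = 𝟭`. [cite: MochizukiEtTh2009, Prop 3.4 (ii) p.74] -/
theorem not_forall_prop34Cnst_ofRlfR_of_ratPrimes :
    ¬ ∀ (D₀ : Type) [Category.{0} D₀] (dm : DivisorMonoids.{0, 0, 0} D₀)
        (hpf : ∀ Y : D₀ᵒᵖ, IsPerfFactorial (dm.Φ₀.obj Y)) (V : FrdIMonoidStub.{0})
        (V₀ : FrdICatStub.{0, 0, 0} D₀) (Dcnst : Type) [Category.{0} Dcnst] (cnst : D₀ ⥤ Dcnst),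
        dm.Prop34 V V₀ → dm.Prop34Cnst₀ cnst →
        (∀ (Y : D₀) (𝔮 : Primes (Perfection (dm.Φ₀.obj (op Y)))), IsQMonoprime (PfAt (dm.Φ₀.obj (op Y)) 𝔮)) →
        (RealifiedDivisorMonoids.ofRlfR dm hpf).Prop34Cnst cnst :=
  fun h => not_prop34Cnst_ofRlfR (h _ dm₁ hpf₁ treeMonoidVocab
    (treeCatVocab (Discrete PUnit.{1}) (fun _ => True) (fun _ => True)) _ (𝟭 _)
    (prop34 (fun _ => True) (fun _ => True)) prop34Cnst₀ (fun _ => hQ))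

end Sec3Prop34CnstOfRlfRSupportNegative

end Literature.AnabelianGeometry.EtaleTheta

end
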